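import Literature.MathematicalPhysics.KineticTheory.InfiniteChainGibbsUniqueness

/-!
# `LatticeLandauDamping.AbelThermodynamicLimit`, line `series-law-at-every-laplace-frequency`:
DLR uniqueness in the one-site-tight class (stub `stub_tightDLRUnique`)

Support file for item `stmt-AtomisticToContinuum-14013`. For `P = pinnedChain ω₂ lam β γ` (all
parameters `> 0`) and `T > 0`, any two DLR Gibbs states at `T` whose one-site POSITION marginals are
uniformly tight (`∀ ε > 0 ∃ R ∀ x, μ{σ | R < |q_x|} ≤ ε`) coincide. One-liner from the Literature theorem
`OscillatorChain.eq_of_isChainGibbsMeasure_of_tight_pinnedChain` (`InfiniteChainGibbsUniqueness.lean`,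
landed by the sibling crux stmt-12596's lead: transfer-operator proof, Georgii 2011 Thm 10.25 / §11.1,
Cassandro–Olivieri–Pellegrinotti–Presutti 1978 §2). This (TU) serves both the regular-class uniqueness
`stub_regularDLRUnique` (superstable ⇒ one-site tight) and the seam `stub_witnessRegularisation`.
-/

noncomputable section

open Literature.MathematicalPhysics.KineticTheory.HeatConduction

namespace Summit.AtomisticToContinuum.FouriersLaw.Theorems.AbelThermodynamicLimit.SeriesLawAtEveryLaplaceFrequency

/-- **Stub `stub_tightDLRUnique` (registered signature, verbatim): DLR UNIQUENESS IN THE ONE-SITE-TIGHT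
CLASS.** For `pinnedChain ω₂ lam β γ` (all `> 0`) and `T > 0`, two DLR Gibbs states at `T` with uniformly
tight one-site position marginals are equal (`OscillatorChain.eq_of_isChainGibbsMeasure_of_tight_pinnedChain`;
`0 < lam`, `0 < β` through `≤`, `0 < γ` decoration). [cite: Georgii2011, Thm 10.25 and §11.1] -/
theorem stub_tightDLRUnique :
    ∀ ω₂ lam β γ : ℝ, 0 < ω₂ → 0 < lam → 0 < β → 0 < γ →
      ∀ T : ℝ, 0 < T →
        ∀ μ₁ μ₂ : MeasureTheory.Measure
            Literature.MathematicalPhysics.KineticTheory.HeatConduction.ChainConfig,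
          (Literature.MathematicalPhysics.KineticTheory.HeatConduction.pinnedChain
              ω₂ lam β γ).IsChainGibbsMeasure T μ₁ →
          (∀ ε : ℝ, 0 < ε → ∃ R : ℝ, ∀ x : ℤ,
            μ₁ {σ : Literature.MathematicalPhysics.KineticTheory.HeatConduction.ChainConfig |
                R < |(σ x).1|} ≤ ENNReal.ofReal ε) →
          (Literature.MathematicalPhysics.KineticTheory.HeatConduction.pinnedChain
              ω₂ lam β γ).IsChainGibbsMeasure T μ₂ →
          (∀ ε : ℝ, 0 < ε → ∃ R : ℝ, ∀ x : ℤ,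
            μ₂ {σ : Literature.MathematicalPhysics.KineticTheory.HeatConduction.ChainConfig |
                R < |(σ x).1|} ≤ ENNReal.ofReal ε) →
          μ₁ = μ₂ :=
  fun _ω₂ _lam _β γ hω hl hβ _hγ _T hT _μ₁ _μ₂ h₁ ht₁ h₂ ht₂ =>
    OscillatorChain.eq_of_isChainGibbsMeasure_of_tight_pinnedChain γ hω hl.le hβ.le hT h₁ h₂ ht₁ ht₂

end Summit.AtomisticToContinuum.FouriersLaw.Theorems.AbelThermodynamicLimit.SeriesLawAtEveryLaplaceFrequency

end
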